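import Summits.AnomalousDissipation.AnomalousDissipation.Theorems.MomentParityLevelNMeasure
import Summits.AnomalousDissipation.AnomalousDissipation.Theorems.MomentParityPathFunctionals

/-!
# Route MomentParity · crux `GalerkinEnsembleRealization` — line `Sketch`, stub `stub_levelDissMean`

The `P`-mean of the unit-time mean of the resolved dissipation `dissMean ν K` over the law
`P = (orbitPathOn)_* (coeff)_* μ` of the level-`N` Galerkin ensemble on the trajectory space
`𝒦 = pathSpace R (pathLip ν A R)` equals the `μ`-mean of the resolved enstrophy (times `ν`):
Fubini on `[0, 1] × 𝒦` (the resolved dissipation is continuous and bounded on the compact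
trajectory space), then at each fixed time the orbit path read through its extension is the
Galerkin orbit (`pathExt_orbitPath`), and the law of the coefficients is invariant under the
Galerkin semiflow (`map_coeff_invariant`), so the inner integral does not depend on time
(stmt-AnomalousDissipation-11466; Foias–Rosa–Temam 2013 arXiv:1111.6257, proof of Thm. 3.1;
Foias–Manley–Rosa–Temam 2001, Ch. IV App. B).
-/

noncomputable section

-- every `Summit.AnomalousDissipation.AnomalousDissipation.…` name repeats the summit = sub-problem segment (D-0017 layout)
set_option linter.dupNamespace false

open MeasureTheory Set Filter Topology Function Metric UnitAddTorus
open scoped BigOperators ENNReal InnerProductSpace RealInnerProductSpace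

namespace Summit.AnomalousDissipation.AnomalousDissipation.Theorems.MomentParity

open Literature.Analysis.FunctionSpaces Literature.Analysis.FunctionSpaces.Torus
open Literature.Analysis.FluidPDE Literature.Analysis.FluidPDE.Torus

variable {ν : ℝ} {f : UnitAddTorus (Fin 3) → EuclideanSpace ℝ (Fin 3)}

/-! ### Fubini on `[0, 1] × 𝒦` -/

/-- **Fubini for the mean resolved dissipation**: against a finite law on the trajectory space,
`∫ dissMean dP = ∫₀¹ (∫ pathDiss(·, t) dP) dt` (the integrand is continuous and bounded on
`𝒦 × ℝ`, `ν ≥ 0`). -/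
private theorem integral_dissMean_eq_intervalIntegral {R : ℝ} {L : (Fin 3 → ℤ) → ℝ}
    (P : Measure ↥(pathSpace (d := Fin 3) R L)) [IsFiniteMeasure P] (hν : 0 ≤ ν) (K : ℕ) :
    ∫ ω, dissMean ν K ω.1 ∂P = ∫ t in (0 : ℝ)..1, ∫ ω, pathDiss ν K ω.1 t ∂P := by
  unfold dissMean
  symm
  apply intervalIntegral_integral_swap
  rw [uIoc_of_le zero_le_one, Function.uncurry_def]
  have hcont : Continuous fun p : ℝ × ↥(pathSpace (d := Fin 3) R L) => pathDiss ν K p.2.1 p.1 := by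
    have h := (continuous_pathDiss R L ν K).comp
      (continuous_swap (X := ℝ) (Y := ↥(pathSpace (d := Fin 3) R L)))
    exact h
  refine Integrable.of_bound hcont.aestronglyMeasurable
    (ν * (4 * Real.pi ^ 2 * ((K : ℝ) ^ 2 * R ^ 2))) (ae_of_all _ fun p => ?_)
  rw [Real.norm_eq_abs, abs_of_nonneg (pathDiss_nonneg hν K _ _)]
  exact pathDiss_le hν K p.2.2 p.1

/-! ### At a fixed time: through the orbit map, and invariance -/

section FixedTime

variable {N : ℕ} {g : ↥(freqBall (d := Fin 3) N) → EuclideanSpace ℂ (Fin 3)} {R : ℝ}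
  {L : (Fin 3 → ℤ) → ℝ}

/-- **The resolved dissipation read through the orbit map**: at a time `t ≥ 0`, for a measure `m`
on the phase space carried by the good set, `∫ pathDiss(ω, t) d(orbitPathOn_* m)` is the
`m`-integral of the resolved enstrophy (times `ν`) of the Galerkin orbit at time `t`. -/
private theorem integral_pathDiss_map_orbitPathOn (hν : 0 ≤ ν) (hg : IsRealCoeff g)
    (ω₀ : ↥(pathSpace (d := Fin 3) R L))
    {m : Measure (↥(freqBall (d := Fin 3) N) → EuclideanSpace ℂ (Fin 3))}
    (hm : m {c | c ∈ galerkinSubspace (freqBall N) ∧ orbitPath ν g c ∈ pathSpace R L}ᶜ = 0)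
    (K : ℕ) {t : ℝ} (ht : 0 ≤ t) :
    ∫ ω, pathDiss ν K ω.1 t ∂(m.map (orbitPathOn ν g R L ω₀)) =
      ∫ c, ν * (4 * Real.pi ^ 2 * ∑ k ∈ freqBall K, freqNormSq k *
        ‖coeffExt (freqBall N) (galerkinCoeffFlow ν g t c) k‖ ^ 2) ∂m := by
  have hPi : AEMeasurable (orbitPathOn ν g R L ω₀) m := aemeasurable_orbitPathOn hν hg ω₀ hm
  -- the integrand is continuous on the trajectory space
  have hcont : Continuous fun ω : ↥(pathSpace (d := Fin 3) R L) => pathDiss ν K ω.1 t := by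
    have h := (continuous_pathDiss R L ν K).comp
      ((continuous_id (X := ↥(pathSpace (d := Fin 3) R L))).prodMk (continuous_const (y := t)))
    exact h
  rw [integral_map hPi hcont.aestronglyMeasurable]
  refine integral_congr_ae ?_
  have hgood : ∀ᵐ c ∂m,
      c ∈ {c | c ∈ galerkinSubspace (freqBall N) ∧ orbitPath ν g c ∈ pathSpace R L} := by
    rw [ae_iff]; exact hm
  filter_upwards [hgood] with c hc
  -- on the good set the orbit path read through its extension is the orbit
  rw [pathDiss, coe_orbitPathOn_of_mem ν g R L ω₀ hc.2]
  simp only [pathExt_orbitPath hν neg_mem_freqBall_of_mem hg hc.1 hc.2 ht]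

/-- **The Galerkin semiflow at a time `t ≥ 0` is a.e. measurable** for every measure on the phase
space carried by the Galerkin subspace (joint continuity of the semiflow). -/
private theorem aemeasurable_galerkinCoeffFlow_of_ae_mem (hν : 0 ≤ ν) (hg : IsRealCoeff g)
    {m : Measure (↥(freqBall (d := Fin 3) N) → EuclideanSpace ℂ (Fin 3))}
    (hV : ∀ᵐ c ∂m, c ∈ galerkinSubspace (freqBall N)) {t : ℝ} (ht : 0 ≤ t) :
    AEMeasurable (galerkinCoeffFlow ν g t) m := by
  set V : Set (↥(freqBall (d := Fin 3) N) → EuclideanSpace ℂ (Fin 3)) :=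
    ((galerkinSubspace (freqBall (d := Fin 3) N) :
        Submodule ℝ (↥(freqBall (d := Fin 3) N) → EuclideanSpace ℂ (Fin 3))) :
      Set (↥(freqBall (d := Fin 3) N) → EuclideanSpace ℂ (Fin 3)))
  have hcont : ContinuousOn (fun c => galerkinCoeffFlow ν g t c) V :=
    (continuousOn_galerkinCoeffFlow hν neg_mem_freqBall_of_mem hg).comp
      (continuousOn_const.prodMk continuousOn_id) fun c hc => ⟨mem_Ici.2 ht, hc⟩
  have hres : m.restrict V = m := Measure.restrict_eq_self_of_ae_mem hV
  rw [← hres]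
  exact hcont.aemeasurable (galerkinSubspace (freqBall N)).closed_of_finiteDimensional.measurableSet

/-- The resolved enstrophy (times `ν`) is a continuous function of the coefficients. -/
private theorem continuous_resolvedEnstrophy (ν : ℝ) (N K : ℕ) :
    Continuous fun c : ↥(freqBall (d := Fin 3) N) → EuclideanSpace ℂ (Fin 3) =>
      ν * (4 * Real.pi ^ 2 * ∑ k ∈ freqBall K, freqNormSq k * ‖coeffExt (freqBall N) c k‖ ^ 2) := by
  refine continuous_const.mul (continuous_const.mul (continuous_finsetSum _ fun k _ => ?_))
  have hk : Continuous fun c : ↥(freqBall (d := Fin 3) N) → EuclideanSpace ℂ (Fin 3) =>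
      coeffExt (freqBall N) c k := by
    by_cases hk : k ∈ freqBall N
    · simp_rw [coeffExt_of_mem _ hk]; exact continuous_apply _
    · simp_rw [coeffExt_of_not_mem _ hk]; exact continuous_const
  exact continuous_const.mul ((hk.norm).pow 2)

end FixedTime

/-- **Invariance at a fixed time**: the `(coeff)_* μ`-mean of the resolved enstrophy of the
Galerkin orbit at a time `t ≥ 0` is the `μ`-mean of the resolved enstrophy
(`map_coeff_invariant`). -/
private theorem integral_resolvedEnstrophy_galerkinCoeffFlow {N : ℕ} {R : ℝ}
    {μ : Measure (Torus.energySpace (Fin 3))} [IsProbabilityMeasure μ] (hν : 0 < ν)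
    (hf : MemLp f 2 volume) (hf0 : HasZeroMean f)
    (h1 : ∀ᵐ u ∂μ, ∀ k ∉ (freqBall N).erase (0 : Fin 3 → ℤ),
      mFourierCoeff (EuclideanSpace.complexify ∘ (u.1 : UnitAddTorus (Fin 3) → EuclideanSpace ℝ (Fin 3))) k = 0)
    (h2 : ∀ᵐ u ∂μ, ‖u‖ ≤ R)
    (h4 : ∀ Φ : CylindricalTest (Fin 3),
      (∀ i, ∀ k ∉ (freqBall N).erase (0 : Fin 3 → ℤ),
        mFourierCoeff (EuclideanSpace.complexify ∘ (Φ.g i)) k = 0) →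
        Integrable (fun u => nsGeneratorPairing ν f u (Φ.grad u)) μ ∧
          ∫ u, nsGeneratorPairing ν f u (Φ.grad u) ∂μ = 0)
    (K : ℕ) {t : ℝ} (ht : 0 ≤ t) :
    ∫ c, ν * (4 * Real.pi ^ 2 * ∑ k ∈ freqBall K, freqNormSq k *
        ‖coeffExt (freqBall N) (galerkinCoeffFlow ν (fourierRestrict (freqBall N) f) t c) k‖ ^ 2)
      ∂(μ.map fun u : Torus.energySpace (Fin 3) =>
        fourierRestrict (freqBall N) (u.1 : UnitAddTorus (Fin 3) → EuclideanSpace ℝ (Fin 3))) =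
      ∫ u, ν * (4 * Real.pi ^ 2 * ∑ k ∈ freqBall K, freqNormSq k *
        ‖coeffExt (freqBall N) (fourierRestrict (freqBall N)
          (u.1 : UnitAddTorus (Fin 3) → EuclideanSpace ℝ (Fin 3))) k‖ ^ 2) ∂μ := by
  have hκm : AEMeasurable (fun u : Torus.energySpace (Fin 3) =>
      fourierRestrict (freqBall N) (u.1 : UnitAddTorus (Fin 3) → EuclideanSpace ℝ (Fin 3))) μ :=
    (continuous_fourierRestrict_coe N).measurable.aemeasurable
  have hgr : IsRealCoeff (fourierRestrict (freqBall N) f) :=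
    isRealCoeff_mFourierCoeff (hf.integrable one_le_two)
  have hV : ∀ᵐ c ∂(μ.map fun u : Torus.energySpace (Fin 3) =>
      fourierRestrict (freqBall N) (u.1 : UnitAddTorus (Fin 3) → EuclideanSpace ℝ (Fin 3))),
      c ∈ galerkinSubspace (freqBall N) :=
    (map_coeff_ae_confined hν hf hf0 h1 h2 h4).mono fun c hc => hc.1
  have hφm := aemeasurable_galerkinCoeffFlow_of_ae_mem hν.le hgr hV ht
  have hG := continuous_resolvedEnstrophy ν N K
  rw [← integral_map hφm hG.aestronglyMeasurable, map_coeff_invariant hν hf hf0 h1 h2 h4 ht,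
    integral_map hκm hG.aestronglyMeasurable]

/-! ### The stub -/

/-- **Stub (level law, mean resolved dissipation by Fubini and invariance).** The `P`-mean of the
unit-time mean of the resolved dissipation is the `μ`-mean of the resolved enstrophy (times `ν`). -/
theorem stub_levelDissMean (hν : 0 < ν) (hf : IsSmooth f) (hf0 : HasZeroMean f) {N : ℕ} {R A : ℝ}
    (hA : ∀ k, ‖coeffExt (freqBall N) (fourierRestrict (freqBall N) f) k‖ ≤ A) (hA0 : 0 ≤ A)
    (ω₀ : ↥(pathSpace R (pathLip ν A R) : Set (Path (Fin 3))))
    {μ : Measure (Torus.energySpace (Fin 3))} [IsProbabilityMeasure μ]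
    (h1 : ∀ᵐ u ∂μ, ∀ k ∉ (freqBall N).erase (0 : Fin 3 → ℤ),
      mFourierCoeff (EuclideanSpace.complexify ∘ (u.1 : UnitAddTorus (Fin 3) → EuclideanSpace ℝ (Fin 3))) k = 0)
    (h2 : ∀ᵐ u ∂μ, ‖u‖ ≤ R)
    (h4 : ∀ Φ : CylindricalTest (Fin 3),
      (∀ i, ∀ k ∉ (freqBall N).erase (0 : Fin 3 → ℤ),
        mFourierCoeff (EuclideanSpace.complexify ∘ (Φ.g i)) k = 0) →
        Integrable (fun u => nsGeneratorPairing ν f u (Φ.grad u)) μ ∧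
          ∫ u, nsGeneratorPairing ν f u (Φ.grad u) ∂μ = 0)
    (K : ℕ) :
    ∫ ω, dissMean ν K ω.1 ∂((μ.map fun u : Torus.energySpace (Fin 3) =>
        fourierRestrict (freqBall N) (u.1 : UnitAddTorus (Fin 3) → EuclideanSpace ℝ (Fin 3))).map
        (orbitPathOn ν (fourierRestrict (freqBall N) f) R (pathLip ν A R) ω₀)) =
      ∫ u, ν * (4 * Real.pi ^ 2 * ∑ k ∈ freqBall K, freqNormSq k *
        ‖coeffExt (freqBall N) (fourierRestrict (freqBall N)
          (u.1 : UnitAddTorus (Fin 3) → EuclideanSpace ℝ (Fin 3))) k‖ ^ 2) ∂μ := by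
  have hκm : AEMeasurable (fun u : Torus.energySpace (Fin 3) =>
      fourierRestrict (freqBall N) (u.1 : UnitAddTorus (Fin 3) → EuclideanSpace ℝ (Fin 3))) μ :=
    (continuous_fourierRestrict_coe N).measurable.aemeasurable
  haveI : IsProbabilityMeasure (μ.map fun u : Torus.energySpace (Fin 3) =>
      fourierRestrict (freqBall N) (u.1 : UnitAddTorus (Fin 3) → EuclideanSpace ℝ (Fin 3))) :=
    Measure.isProbabilityMeasure_map hκm
  have hgr : IsRealCoeff (fourierRestrict (freqBall N) f) := isRealCoeff_mFourierCoeff hf.integrable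
  have hm := map_coeff_compl_good_eq_zero hν (hf.memLp 2) hf0 hA hA0 h1 h2 h4
  have hPi : AEMeasurable (orbitPathOn ν (fourierRestrict (freqBall N) f) R (pathLip ν A R) ω₀)
      (μ.map fun u : Torus.energySpace (Fin 3) =>
        fourierRestrict (freqBall N) (u.1 : UnitAddTorus (Fin 3) → EuclideanSpace ℝ (Fin 3))) :=
    aemeasurable_orbitPathOn hν.le hgr ω₀ hm
  haveI : IsProbabilityMeasure ((μ.map fun u : Torus.energySpace (Fin 3) =>
      fourierRestrict (freqBall N) (u.1 : UnitAddTorus (Fin 3) → EuclideanSpace ℝ (Fin 3))).map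
        (orbitPathOn ν (fourierRestrict (freqBall N) f) R (pathLip ν A R) ω₀)) :=
    Measure.isProbabilityMeasure_map hPi
  rw [integral_dissMean_eq_intervalIntegral _ hν.le K]
  rw [intervalIntegral.integral_congr (g := fun _ => ∫ u, ν * (4 * Real.pi ^ 2 *
      ∑ k ∈ freqBall K, freqNormSq k * ‖coeffExt (freqBall N) (fourierRestrict (freqBall N)
        (u.1 : UnitAddTorus (Fin 3) → EuclideanSpace ℝ (Fin 3))) k‖ ^ 2) ∂μ) ?_]
  · simp
  · intro t ht
    rw [uIcc_of_le zero_le_one] at ht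
    beta_reduce
    rw [integral_pathDiss_map_orbitPathOn hν.le hgr ω₀ hm K ht.1]
    exact integral_resolvedEnstrophy_galerkinCoeffFlow hν (hf.memLp 2) hf0 h1 h2 h4 K ht.1

end Summit.AnomalousDissipation.AnomalousDissipation.Theorems.MomentParity
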